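import Literature.Computability.AlgebraicComplexity.BILPS19LatinRectangleConditionAlonTarsi
import HarnessLib

/-!
# The Latin-rectangle condition is additive in the number of vectors:
# `LRC(α, β₁) ∧ LRC(α, β₂) ⇒ LRC(α, β₁ + β₂)`; hence `LRC(α, β)` for EVERY even `β ≥ α` when
# `α ≤ 12`, and BILPS Thm 27 unconditionally for `k ≤ 12` and all even `m`

Bläser–Ikenmeyer–Lysikov–Pandey–Schreyer, arXiv:1911.02534, §7.3 (held text `paper:arxiv-1911.02534`
p0026:L21–33): Conjecture 26 = `LRC(α, β)` (typed HYPOTHESIS `latinRectangleCondition α β` of the tree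
fact `BILPS2019_thm27`, itself discharged as `BILPS2019_thm27_holds`), with the printed remark
(p0026:L29) "The fact that `LRC(α, β)` is true for all even `β` and `α ≤ 5` follows from recent work on
Foulkes' conjecture, see [MN:05, McK:08, CIM:15]."

This theorem-only file PROVES that printed claim — for `α ≤ 12` rather than `α ≤ 5`, and by an
ELEMENTARY route that does not use the Foulkes–Howe results cited in print — from the sibling file
`BILPS19LatinRectangleConditionAlonTarsi.lean` (`LRC(α, β) ⇔` some pattern `𝒜` of size `(α, β)` has
`♯L⁺_𝒜 ≠ ♯L⁻_𝒜`; `LRC(α, β)` for all `α ≤ β`, `β` even `≤ 24`, from the tree's Alon–Tarsi theorems):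

* `signedCount_blockSum` — **signed Latin-rectangle counts are multiplicative over block sums of
  patterns**: for patterns `𝒜₁` of size `(α, β₁)` and `𝒜₂` of size `(α, β₂)`, the block pattern
  `𝒜₁ ⊞ 𝒜₂` on `[β₁ + β₂]` (columns `< β₁` carry the sets of `𝒜₁`, the others the sets of `𝒜₂` shifted
  by `β₁`) has `♯L⁺ − ♯L⁻ = (♯L⁺_{𝒜₁} − ♯L⁻_{𝒜₁}) · (♯L⁺_{𝒜₂} − ♯L⁻_{𝒜₂})`: a Latin rectangle with a
  block pattern is exactly a pair of Latin rectangles (each row, being injective and mapping each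
  block of columns into the corresponding block of symbols, is a bijection blockwise), and Kumar's
  column sign is multiplicative (a column keeps its inversions under the monotone shift).
* `latinRectangleCondition_add` — **`LRC(α, β₁) → LRC(α, β₂) → LRC(α, β₁ + β₂)`**;
  `latinRectangleCondition_mul` — `LRC(α, β) → LRC(α, k β)` (`1 ≤ k`).
* `latinRectangleCondition_of_le_twelve` — **`LRC(α, β)` for every `α ≤ 12` and every even
  `β ≥ α`** (write an even `β ≥ 26` as `12 + (β − 12)` and induct; the parts are even numbers in
  `[12, 24]`, where `LRC` holds unconditionally by `latinRectangleCondition_of_even_le_24`); with the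
  odd-`β` failure of the sibling file `BILPS19LatinRectangleConditionProofs.lean`:
  `latinRectangleCondition_iff_even_of_le_twelve` — **for `2 ≤ α ≤ 12` and `α ≤ β`:
  `LRC(α, β) ⇔ β` even.**
* `BILPS2019_thm27_of_even_of_le_twelve` — **BILPS Thm 27 UNCONDITIONALLY for every `k ≤ 12` and
  every even `m`**: for `m ≤ n`, `kr < m`, `kr < n`, `k ≤ m`, the minrank variety `𝓜_r ⊆ F^{k×m×n}`
  has a nonzero homogeneous equation of degree `km` (`F` algebraically closed, characteristic `0`).

Scope (honest): for `α ≥ 13` additivity still propagates the unconditional bases (even `β ≤ 24`,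
`β = p ± 1`) to all their sums with parts `≥ α`, but not to every even `β` (e.g. `LRC(13, 26)` is not
reached; `LRC(26, 26)` is Alon–Tarsi for `26`, open in print). Faithfulness: the printed sentence
(p0026:L29, `α ≤ 5`, all even `β`) is now a THEOREM of the tree (`latinRectangleCondition_of_le_twelve`
with `α ≤ 5 ≤ 12`); the route (block additivity + Drisko/Glynn + Kumar) is ours, not the cited
Foulkes-conjecture papers [MN:05, McK:08, CIM:15], which are not formalised. No definitions, no named
facts; nothing here bears on `VP ≠ VNP` (equations for the MINRANK varieties).

## References
* [BlaserIkenmeyerLysikovPandeySchreyer2019] arXiv:1911.02534, §7.3: Conj. 26, the remarks after it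
  (p0026:L28–33), Thm. 27 (p0026:L36–40).
* [Kumar2015] S. Kumar, Compositio Math. 151 (2015), Def. 4.1 (patterns, column signs).
-/

noncomputable section

open Finset Equiv

namespace Literature.Computability.AlgebraicComplexity

namespace BILPS2019

open Kumar2015 Literature.Barriers.ValiantsHypothesis MvPolynomial

variable {α β₁ β₂ : ℕ}

/-! ## Column signs are invariant under monotone relabelling and multiplicative over blocks -/

/-- Kumar's sequence sign only sees the relative order: composing with a strictly increasing map
does not change it. [cite: Kumar2015, Def. 4.1 (ε(A^q))] -/
theorem seqSign_strictMono_comp {ι κ : Type*} [LinearOrder ι] [LinearOrder κ] {i : ℕ}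
    (g : Fin i → ι) {e : ι → κ} (he : StrictMono e) : seqSign (e ∘ g) = seqSign g := by
  unfold seqSign
  refine Finset.prod_congr rfl fun p _ => Finset.prod_congr rfl fun p' _ => ?_
  simp only [Function.comp_apply, he.lt_iff_lt]

/-- The column sign of a block sum of arrays is the product of the column signs of the blocks.
[cite: Kumar2015, Def. 4.1 (ε_c)] -/
theorem rectColSign_blockSum (R₁ : Fin α → Fin β₁ → Fin β₁) (R₂ : Fin α → Fin β₂ → Fin β₂) :
    rectColSign (fun p => Fin.append (fun j => Fin.castAdd β₂ (R₁ p j))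
        (fun j => Fin.natAdd β₁ (R₂ p j))) = rectColSign R₁ * rectColSign R₂ := by
  unfold rectColSign
  rw [Fin.prod_univ_add]
  congr 1
  · refine Finset.prod_congr rfl fun j _ => ?_
    have : (fun p => Fin.append (fun j => Fin.castAdd β₂ (R₁ p j)) (fun j => Fin.natAdd β₁ (R₂ p j))
        (Fin.castAdd β₂ j)) = Fin.castAdd β₂ ∘ fun p => R₁ p j := by
      funext p
      simp only [Fin.append_left, Function.comp_apply]
    rw [this, seqSign_strictMono_comp _ (Fin.strictMono_castAdd β₂)]
  · refine Finset.prod_congr rfl fun j _ => ?_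
    have : (fun p => Fin.append (fun j => Fin.castAdd β₂ (R₁ p j)) (fun j => Fin.natAdd β₁ (R₂ p j))
        (Fin.natAdd β₁ j)) = Fin.natAdd β₁ ∘ fun p => R₂ p j := by
      funext p
      simp only [Fin.append_right, Function.comp_apply]
    rw [this, seqSign_strictMono_comp _ (Fin.strictMono_natAdd β₁)]

/-! ## Block sums of Latin rectangles and of patterns -/

/-- The block sum of two Latin rectangles is a Latin rectangle. [cite: Kumar2015, Def. 4.1] -/
theorem isLatinRect_blockSum {R₁ : Fin α → Fin β₁ → Fin β₁} {R₂ : Fin α → Fin β₂ → Fin β₂}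
    (h₁ : IsLatinRect R₁) (h₂ : IsLatinRect R₂) :
    IsLatinRect (fun p => Fin.append (fun j => Fin.castAdd β₂ (R₁ p j))
      (fun j => Fin.natAdd β₁ (R₂ p j))) := by
  refine ⟨fun p => ?_, fun j => ?_⟩
  · refine Finite.injective_iff_bijective.mp fun j j' hjj' => ?_
    have hv := congrArg Fin.val hjj'
    induction j using Fin.addCases with
    | left i =>
      induction j' using Fin.addCases with
      | left i' =>
        simp only [Fin.append_left, Fin.val_castAdd] at hv
        rw [(h₁.1 p).1 (Fin.ext hv)]
      | right i' =>
        simp only [Fin.append_left, Fin.append_right, Fin.val_castAdd, Fin.val_natAdd] at hv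
        have := (R₁ p i).2
        omega
    | right i =>
      induction j' using Fin.addCases with
      | left i' =>
        simp only [Fin.append_left, Fin.append_right, Fin.val_castAdd, Fin.val_natAdd] at hv
        have := (R₁ p i').2
        omega
      | right i' =>
        simp only [Fin.append_right, Fin.val_natAdd] at hv
        have hii' : R₂ p i = R₂ p i' := Fin.ext (by omega)
        rw [(h₂.1 p).1 hii']
  · induction j using Fin.addCases with
    | left i =>
      intro p p' hpp'
      simp only [Fin.append_left] at hpp'
      exact h₁.2 i (Fin.castAdd_injective _ _ hpp')
    | right i =>
      intro p p' hpp'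
      simp only [Fin.append_right] at hpp'
      exact h₂.2 i (Fin.natAdd_injective _ _ hpp')

/-- The pattern of a block sum is the block sum of the patterns. [cite: Kumar2015, Def. 4.1 (pattern)] -/
theorem pattern_blockSum (R₁ : Fin α → Fin β₁ → Fin β₁) (R₂ : Fin α → Fin β₂ → Fin β₂) :
    pattern (fun p => Fin.append (fun j => Fin.castAdd β₂ (R₁ p j))
        (fun j => Fin.natAdd β₁ (R₂ p j))) =
      Fin.append (fun j => (pattern R₁ j).image (Fin.castAdd β₂))
        (fun j => (pattern R₂ j).image (Fin.natAdd β₁)) := by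
  classical
  funext j
  induction j using Fin.addCases with
  | left i =>
    unfold pattern
    simp only [Fin.append_left, Finset.image_image]
    rfl
  | right i =>
    unfold pattern
    simp only [Fin.append_right, Finset.image_image]
    rfl

/-! ## Multiplicativity of signed counts over block sums -/

/-- **Signed Latin-rectangle counts are multiplicative over block sums of patterns**:
`(♯L⁺ − ♯L⁻)(𝒜₁ ⊞ 𝒜₂) = (♯L⁺_{𝒜₁} − ♯L⁻_{𝒜₁}) · (♯L⁺_{𝒜₂} − ♯L⁻_{𝒜₂})`, the block pattern
`𝒜₁ ⊞ 𝒜₂ : [β₁ + β₂] → 𝒫([β₁ + β₂])` carrying the sets of `𝒜₁` on the first `β₁` columns and the sets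
of `𝒜₂`, shifted by `β₁`, on the last `β₂`. A Latin rectangle with pattern `𝒜₁ ⊞ 𝒜₂` is exactly a block
sum of a Latin rectangle with pattern `𝒜₁` and one with pattern `𝒜₂` (each row maps each block of
columns injectively into the corresponding block of symbols, hence bijectively), and column signs
multiply (`rectColSign_blockSum`). [cite: Kumar2015, Def. 4.1 and Lemma 4.2 (signed counts ♯L⁺_𝒜 − ♯L⁻_𝒜)] -/
theorem signedCount_blockSum (A₁ : Fin β₁ → Finset (Fin β₁)) (A₂ : Fin β₂ → Finset (Fin β₂)) :
    signedCount α (β₁ + β₂) (Fin.append (fun j => (A₁ j).image (Fin.castAdd β₂))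
        (fun j => (A₂ j).image (Fin.natAdd β₁))) =
      signedCount α β₁ A₁ * signedCount α β₂ A₂ := by
  classical
  -- the glue and its (total) inverse
  let glue : (Fin α → Fin β₁ → Fin β₁) × (Fin α → Fin β₂ → Fin β₂) →
      (Fin α → Fin (β₁ + β₂) → Fin (β₁ + β₂)) := fun x p =>
    Fin.append (fun j => Fin.castAdd β₂ (x.1 p j)) (fun j => Fin.natAdd β₁ (x.2 p j))
  let proj₁ : (Fin α → Fin (β₁ + β₂) → Fin (β₁ + β₂)) → (Fin α → Fin β₁ → Fin β₁) := fun R p i =>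
    if h : ((R p (Fin.castAdd β₂ i) : Fin (β₁ + β₂)) : ℕ) < β₁ then ⟨_, h⟩ else i
  let proj₂ : (Fin α → Fin (β₁ + β₂) → Fin (β₁ + β₂)) → (Fin α → Fin β₂ → Fin β₂) := fun R p i =>
    if h : β₁ ≤ ((R p (Fin.natAdd β₁ i) : Fin (β₁ + β₂)) : ℕ) then
      ⟨(R p (Fin.natAdd β₁ i) : ℕ) - β₁, by have := (R p (Fin.natAdd β₁ i)).2; omega⟩ else i
  -- unfold the three signed counts
  unfold signedCount
  rw [Finset.sum_mul_sum, ← Finset.sum_product']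
  symm
  refine Finset.sum_nbij' glue (fun R => (proj₁ R, proj₂ R)) (fun x hx => ?_) (fun R hR => ?_)
    (fun x _ => ?_) (fun R hR => ?_) (fun x _ => ?_)
  · -- glue lands in the Latin rectangles with the block pattern
    simp only [Finset.mem_product, Finset.mem_filter, Finset.mem_univ, true_and] at hx
    obtain ⟨⟨hL₁, hP₁⟩, ⟨hL₂, hP₂⟩⟩ := hx
    refine Finset.mem_filter.mpr ⟨Finset.mem_univ _, isLatinRect_blockSum hL₁ hL₂, ?_⟩
    rw [pattern_blockSum, hP₁, hP₂]
  · -- the projections of a Latin rectangle with the block pattern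
    simp only [Finset.mem_filter, Finset.mem_univ, true_and] at hR
    obtain ⟨hL, hP⟩ := hR
    have hlt : ∀ p i, ((R p (Fin.castAdd β₂ i) : Fin (β₁ + β₂)) : ℕ) < β₁ := by
      intro p i
      have hm : R p (Fin.castAdd β₂ i) ∈ pattern R (Fin.castAdd β₂ i) :=
        Finset.mem_image_of_mem _ (Finset.mem_univ p)
      rw [hP, Fin.append_left, Finset.mem_image] at hm
      obtain ⟨x, -, hx⟩ := hm
      rw [← hx]
      exact x.2
    have hle : ∀ p i, β₁ ≤ ((R p (Fin.natAdd β₁ i) : Fin (β₁ + β₂)) : ℕ) := by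
      intro p i
      have hm : R p (Fin.natAdd β₁ i) ∈ pattern R (Fin.natAdd β₁ i) :=
        Finset.mem_image_of_mem _ (Finset.mem_univ p)
      rw [hP, Fin.append_right, Finset.mem_image] at hm
      obtain ⟨x, -, hx⟩ := hm
      rw [← hx]
      simp
    have hc₁ : ∀ p i, Fin.castAdd β₂ (proj₁ R p i) = R p (Fin.castAdd β₂ i) := by
      intro p i
      apply Fin.ext
      simp only [proj₁, dif_pos (hlt p i), Fin.val_castAdd]
    have hc₂ : ∀ p i, Fin.natAdd β₁ (proj₂ R p i) = R p (Fin.natAdd β₁ i) := by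
      intro p i
      apply Fin.ext
      simp only [proj₂, dif_pos (hle p i), Fin.val_natAdd]
      have := hle p i
      omega
    simp only [Finset.mem_product, Finset.mem_filter, Finset.mem_univ, true_and]
    refine ⟨⟨⟨fun p => ?_, fun i => ?_⟩, ?_⟩, ⟨⟨fun p => ?_, fun i => ?_⟩, ?_⟩⟩
    · refine Finite.injective_iff_bijective.mp fun i i' hii' => ?_
      have h := congrArg (Fin.castAdd β₂) hii'
      rw [hc₁, hc₁] at h
      exact Fin.castAdd_injective _ _ ((hL.1 p).1 h)
    · intro p p' hpp'
      have h := congrArg (Fin.castAdd β₂) hpp'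
      simp only [hc₁] at h
      exact hL.2 _ h
    · funext i
      ext x
      have hx : x ∈ A₁ i ↔ Fin.castAdd β₂ x ∈ pattern R (Fin.castAdd β₂ i) := by
        rw [hP, Fin.append_left, Finset.mem_image]
        constructor
        · exact fun h => ⟨x, h, rfl⟩
        · rintro ⟨y, hy, hyx⟩
          rwa [← Fin.castAdd_injective _ _ hyx]
      rw [hx]
      unfold pattern
      simp only [Finset.mem_image, Finset.mem_univ, true_and]
      constructor
      · rintro ⟨p, hp⟩
        exact ⟨p, by rw [← hp, hc₁]⟩
      · rintro ⟨p, hp⟩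
        exact ⟨p, Fin.castAdd_injective _ _ (by rw [hc₁, hp])⟩
    · refine Finite.injective_iff_bijective.mp fun i i' hii' => ?_
      have h := congrArg (Fin.natAdd β₁) hii'
      rw [hc₂, hc₂] at h
      exact Fin.natAdd_injective _ _ ((hL.1 p).1 h)
    · intro p p' hpp'
      have h := congrArg (Fin.natAdd β₁) hpp'
      simp only [hc₂] at h
      exact hL.2 _ h
    · funext i
      ext x
      have hx : x ∈ A₂ i ↔ Fin.natAdd β₁ x ∈ pattern R (Fin.natAdd β₁ i) := by
        rw [hP, Fin.append_right, Finset.mem_image]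
        constructor
        · exact fun h => ⟨x, h, rfl⟩
        · rintro ⟨y, hy, hyx⟩
          rwa [← Fin.natAdd_injective _ _ hyx]
      rw [hx]
      unfold pattern
      simp only [Finset.mem_image, Finset.mem_univ, true_and]
      constructor
      · rintro ⟨p, hp⟩
        exact ⟨p, by rw [← hp, hc₂]⟩
      · rintro ⟨p, hp⟩
        exact ⟨p, Fin.natAdd_injective _ _ (by rw [hc₂, hp])⟩
  · -- proj ∘ glue = id
    obtain ⟨R₁, R₂⟩ := x
    refine Prod.ext ?_ ?_
    · funext p i
      apply Fin.ext
      have h : ((glue (R₁, R₂) p (Fin.castAdd β₂ i) : Fin (β₁ + β₂)) : ℕ) = R₁ p i := by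
        simp only [glue, Fin.append_left, Fin.val_castAdd]
      simp only [proj₁, h, (R₁ p i).2, dif_pos]
    · funext p i
      apply Fin.ext
      have h : ((glue (R₁, R₂) p (Fin.natAdd β₁ i) : Fin (β₁ + β₂)) : ℕ) = β₁ + R₂ p i := by
        simp only [glue, Fin.append_right, Fin.val_natAdd]
      simp only [proj₂, h, Nat.le_add_right, dif_pos, Nat.add_sub_cancel_left]
  · -- glue ∘ proj = id on Latin rectangles with the block pattern
    simp only [Finset.mem_filter, Finset.mem_univ, true_and] at hR
    obtain ⟨-, hP⟩ := hR
    funext p j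
    induction j using Fin.addCases with
    | left i =>
      have hm : R p (Fin.castAdd β₂ i) ∈ pattern R (Fin.castAdd β₂ i) :=
        Finset.mem_image_of_mem _ (Finset.mem_univ p)
      rw [hP, Fin.append_left, Finset.mem_image] at hm
      obtain ⟨x, -, hx⟩ := hm
      apply Fin.ext
      simp only [glue, proj₁, Fin.append_left, ← hx, Fin.val_castAdd, x.2, dif_pos]
    | right i =>
      have hm : R p (Fin.natAdd β₁ i) ∈ pattern R (Fin.natAdd β₁ i) :=
        Finset.mem_image_of_mem _ (Finset.mem_univ p)
      rw [hP, Fin.append_right, Finset.mem_image] at hm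
      obtain ⟨x, -, hx⟩ := hm
      apply Fin.ext
      simp only [glue, proj₂, Fin.append_right, ← hx, Fin.val_natAdd, Nat.le_add_right, dif_pos,
        Nat.add_sub_cancel_left]
  · -- the signs multiply
    obtain ⟨R₁, R₂⟩ := x
    simp only [glue]
    rw [rectColSign_blockSum, Units.val_mul]

/-! ## Additivity of `LRC` in `β` -/

/-- **`LRC(α, β₁) ∧ LRC(α, β₂) ⇒ LRC(α, β₁ + β₂)`**: take patterns with nonzero signed counts
(`latinRectangleCondition_iff_exists_signedCount_ne_zero`) and form their block sum
(`signedCount_blockSum`). [cite: BlaserIkenmeyerLysikovPandeySchreyer2019, §7.3 (Conj. 26)] [cite: Kumar2015, Lemma 4.2] -/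
theorem latinRectangleCondition_add (h₁ : latinRectangleCondition α β₁)
    (h₂ : latinRectangleCondition α β₂) : latinRectangleCondition α (β₁ + β₂) := by
  obtain ⟨A₁, hA₁⟩ := latinRectangleCondition_iff_exists_signedCount_ne_zero.mp h₁
  obtain ⟨A₂, hA₂⟩ := latinRectangleCondition_iff_exists_signedCount_ne_zero.mp h₂
  refine latinRectangleCondition_iff_exists_signedCount_ne_zero.mpr
    ⟨Fin.append (fun j => (A₁ j).image (Fin.castAdd β₂)) (fun j => (A₂ j).image (Fin.natAdd β₁)),
      ?_⟩
  rw [signedCount_blockSum]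
  exact mul_ne_zero hA₁ hA₂

/-- `LRC(α, β) ⇒ LRC(α, k β)` for `1 ≤ k`. [cite: BlaserIkenmeyerLysikovPandeySchreyer2019, §7.3 (Conj. 26)] -/
theorem latinRectangleCondition_mul {α β k : ℕ} (hk : 1 ≤ k) (h : latinRectangleCondition α β) :
    latinRectangleCondition α (k * β) := by
  induction k, hk using Nat.le_induction with
  | base => simpa using h
  | succ n _ ih =>
    rw [Nat.succ_mul]
    exact latinRectangleCondition_add ih h

/-- In particular Alon–Tarsi for `β` gives `LRC(α, k β)` for all `α ≤ β` and `k ≥ 1`.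
[cite: BlaserIkenmeyerLysikovPandeySchreyer2019, §7.3 (remarks after Conj. 26)] -/
theorem latinRectangleCondition_mul_of_alonTarsi {α β k : ℕ} (hαβ : α ≤ β) (hk : 1 ≤ k)
    (h : AlonTarsiConjecture β) : latinRectangleCondition α (k * β) :=
  latinRectangleCondition_mul hk (latinRectangleCondition_of_alonTarsi hαβ h)

/-! ## `LRC(α, β)` for all even `β` when `α ≤ 12` -/

/-- **`LRC(α, β)` for every `α ≤ 12` and every even `β ≥ α`** — the printed claim "`LRC(α, β)` is
true for all even `β` and `α ≤ 5`" (p0026:L29, there via Foulkes' conjecture [MN:05, McK:08, CIM:15])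
and more, here from the unconditional bases `LRC(α, b)`, `b` even in `[α, 24]`
(`latinRectangleCondition_of_even_le_24`, Drisko/Glynn + Kumar) and additivity: an even `β ≥ 26` is
`12 + (β − 12)` with `β − 12 ≥ 14` even. [cite: BlaserIkenmeyerLysikovPandeySchreyer2019, §7.3 (remarks after Conj. 26, "α ≤ 5")] -/
theorem latinRectangleCondition_of_le_twelve {α β : ℕ} (hα : α ≤ 12) (hαβ : α ≤ β) (hβ : Even β) :
    latinRectangleCondition α β := by
  induction β using Nat.strong_induction_on with
  | _ β ih =>
    rcases Nat.eq_zero_or_pos β with rfl | hpos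
    · obtain rfl : α = 0 := Nat.le_zero.mp hαβ
      exact latinRectangleCondition_zero_right 0
    · have h2 : 2 ≤ β := by obtain ⟨t, rfl⟩ := hβ; omega
      by_cases h24 : β ≤ 24
      · exact latinRectangleCondition_of_even_le_24 hαβ hβ h2 h24
      · have h12 : latinRectangleCondition α 12 :=
          latinRectangleCondition_of_even_le_24 hα ⟨6, rfl⟩ (by norm_num) (by norm_num)
        have hrest : latinRectangleCondition α (β - 12) := by
          refine ih (β - 12) (by omega) (by omega) ?_
          obtain ⟨t, rfl⟩ := hβ
          exact ⟨t - 6, by omega⟩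
        have := latinRectangleCondition_add h12 hrest
        rwa [Nat.add_sub_cancel' (by omega : 12 ≤ β)] at this

/-- **For `2 ≤ α ≤ 12` and `α ≤ β`: `LRC(α, β) ⇔ β` is even** (odd `β` fails by the row-swap
involution, `not_latinRectangleCondition_of_odd`). [cite: BlaserIkenmeyerLysikovPandeySchreyer2019, §7.3 (Conj. 26 and the remarks after it)] -/
theorem latinRectangleCondition_iff_even_of_le_twelve {α β : ℕ} (h2 : 2 ≤ α) (hα : α ≤ 12)
    (hαβ : α ≤ β) : latinRectangleCondition α β ↔ Even β := by
  refine ⟨fun h => ?_, latinRectangleCondition_of_le_twelve hα hαβ⟩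
  by_contra hodd
  exact not_latinRectangleCondition_of_odd h2 (Nat.not_even_iff_odd.mp hodd) h

/-- `LRC(3, β)`, `LRC(4, β)`, `LRC(5, β)` for every even `β ≥ α` — the three instances named in print
("α ≤ 5"). [cite: BlaserIkenmeyerLysikovPandeySchreyer2019, §7.3 (remarks after Conj. 26, "α ≤ 5")] -/
theorem latinRectangleCondition_of_le_five {α β : ℕ} (hα : α ≤ 5) (hαβ : α ≤ β) (hβ : Even β) :
    latinRectangleCondition α β :=
  latinRectangleCondition_of_le_twelve (hα.trans (by norm_num)) hαβ hβ

end BILPS2019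

/-! ## BILPS Thm 27, unconditionally for `k ≤ 12` and all even `m` -/

open BILPS2019 Literature.Barriers.ValiantsHypothesis

/-- **BILPS Thm 27 UNCONDITIONALLY for every `k ≤ 12` and every even `m`**: for `m ≤ n`, `kr < m`,
`kr < n`, `k ≤ m`, `k ≤ 12`, `m` even, the minrank variety `𝓜_r ⊆ F^{k×m×n}` (`F` algebraically closed
of characteristic `0`) has a nonzero homogeneous equation of degree `km` — the typed Thm 27
(`BILPS2019_thm27_holds`) with its hypothesis `LRC(k, m)` DISCHARGED by
`latinRectangleCondition_of_le_twelve`. (For odd `m` and `k ≥ 2` the hypothesis is false, and the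
typed statement says nothing.) [cite: BlaserIkenmeyerLysikovPandeySchreyer2019, Thm. 27 and §7.3 (remarks after Conj. 26)] -/
theorem BILPS2019_thm27_of_even_of_le_twelve (F : Type) [Field F] [IsAlgClosed F] [CharZero F]
    (k m n r : ℕ) (hmn : m ≤ n) (hm : k * r < m) (hn : k * r < n) (hk : k ≤ 12) (hkm : k ≤ m)
    (heven : Even m) :
    ∃ f : MvPolynomial (Fin k × Fin m × Fin n) F, f ≠ 0 ∧ f.IsHomogeneous (k * m) ∧
      ∀ T ∈ (minrankSet F r : Set (Fin k → Fin m → Fin n → F)),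
        MvPolynomial.eval (trilinearPt T) f = 0 :=
  BILPS2019_thm27_holds F k m n r hmn hm hn (latinRectangleCondition_of_le_twelve hk hkm heven)

/-- BILPS Thm 27 with the Latin-rectangle hypothesis replaced by additivity from ANY two shapes:
`LRC(k, m₁) ∧ LRC(k, m₂)` give the degree-`k(m₁+m₂)` equations of `𝓜_r ⊆ F^{k×(m₁+m₂)×n}`.
[cite: BlaserIkenmeyerLysikovPandeySchreyer2019, Thm. 27] -/
theorem BILPS2019_thm27_of_add (F : Type) [Field F] [IsAlgClosed F] [CharZero F]
    (k m₁ m₂ n r : ℕ) (hmn : m₁ + m₂ ≤ n) (hm : k * r < m₁ + m₂) (hn : k * r < n)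
    (h₁ : latinRectangleCondition k m₁) (h₂ : latinRectangleCondition k m₂) :
    ∃ f : MvPolynomial (Fin k × Fin (m₁ + m₂) × Fin n) F, f ≠ 0 ∧
      f.IsHomogeneous (k * (m₁ + m₂)) ∧
      ∀ T ∈ (minrankSet F r : Set (Fin k → Fin (m₁ + m₂) → Fin n → F)),
        MvPolynomial.eval (trilinearPt T) f = 0 :=
  BILPS2019_thm27_holds F k (m₁ + m₂) n r hmn hm hn (latinRectangleCondition_add h₁ h₂)

end Literature.Computability.AlgebraicComplexity
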